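import Mathlib
import Summits.Ventures.PercRepro2.KPrimeReduction
import Summits.Ventures.PercRepro2.KPrimeTiltO1

/-!
# The tilt step `(TILT)` of the frozen glue is fact `(a)` plus fact `(e)`
(blind cell PercRepro2, mine-c g39; `conjectures/MINE-C.md` §47.8, §48.0)

Roots `a₁, a₂`, vertices `v, y, z`; `Ω = {a₁ ↮ a₂}`, `S = {a₂ ↮ {a₁, v}}`, `N = {a₁ ↮ {a₂, v}}`,
`U = {a₁ ↔ v}`, `Y = {a₂ ↔ y}`, `Z̄ = {a₂ ↮ z}`, the class `(0,1) = {v ∉ C₁, y ∈ C₁} ∩ S`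
(`cls01`) and `Bev = (U ∩ Ω ∩ Yᶜ) ∪ (0,1)` (`bev`).  With the masses
`Sm = P(S)`, `YS = P(Y ∩ S)`, `H = P(U ∩ Ω)`, `D = P(U ∩ Y ∩ Ω)`, `D₀ = P(N)` and `M_Z̄ = P(M ∩ Z̄)`:

* `factEForm` is the cleared form of fact `(e)` of `MINE-C.md` §47.8,
  `(YS·H_Z̄ − Sm·D_Z̄)·D₀ − (YS·H − Sm·D)·D₀_Z̄` (`(e)` is `0 ≤ factEForm`; census-true,
  `MINE-C.md` §48.0: 0 / 1,284 instances; not yet proved);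
* `tiltForm` is the cleared form of the one-world tilt inequality `(TILT)` of §47.8 (c),
  `Sm·(Bev_Z̄·D₀ − Bev·D₀_Z̄) − (Sm − YS)·(H_Z̄·D₀ − H·D₀_Z̄)` (`(TILT)` is `0 ≤ tiltForm`);
* **`tiltForm_eq`**: `(TILT)` is exactly `Sm · (a) + (e)` — `tiltForm = Sm · (P((0,1) ∩ Z̄)·P(N) −
  P((0,1))·P(N ∩ Z̄)) + factEForm` — and **`tiltForm_nonneg_of_factEForm_nonneg`**: since `(a)` is the
  theorem `cls01_avoid_a2_pa_harris'` (`KPrimeTiltO1.lean`), `(TILT)` follows from fact `(e)` alone;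
* `factEForm_nonneg_of_z_eq_v`, `factEForm_nonneg_of_z_eq_y`: the two degenerate cases of `(e)` are theorems
  (`z = v`: `Z̄ ⊇ U ∩ Ω` and BHK 1.4; `z = y`: `Y ∩ Z̄ = ∅`, BHK 1.4 and `YS ≤ Sm`).
-/

namespace Summit.Ventures.PercRepro2

namespace KPrime

variable {V : Type*} {E : Type*} [Fintype E] [DecidableEq E] [Fintype V] [DecidableEq V]
  {R : Type*} [Field R] [LinearOrder R] [IsStrictOrderedRing R]

section Statements

variable (ends : E → Sym2 V) (a₁ a₂ v y z : V) (p : E → R)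

/-- The class `Bev = (U ∩ Ω ∩ Yᶜ) ∪ (0,1)` of `MINE-C.md` §47.8 (c). -/
def bev : Set (Config E) :=
  (connEvent ends a₁ v ∩ Ω ends a₁ a₂ ∩ (connEvent ends a₂ y)ᶜ) ∪ cls01 ends a₁ a₂ v y

/-- **Fact `(e)`** of `MINE-C.md` §47.8 as a cleared form (`(e)` is `0 ≤ factEForm`):
`(YS·H_Z̄ − Sm·D_Z̄)·D₀ − (YS·H − Sm·D)·D₀_Z̄` with `Z̄ = {a₂ ↮ z}`. -/
noncomputable def factEForm : R :=
  (prob p (connEvent ends a₂ y ∩ S ends a₁ a₂ v) *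
        prob p (connEvent ends a₁ v ∩ Ω ends a₁ a₂ ∩ avoidAll ends a₂ {z}) -
      prob p (S ends a₁ a₂ v) *
        prob p (connEvent ends a₁ v ∩ connEvent ends a₂ y ∩ Ω ends a₁ a₂ ∩ avoidAll ends a₂ {z})) *
      prob p (N ends a₁ a₂ v) -
    (prob p (connEvent ends a₂ y ∩ S ends a₁ a₂ v) * prob p (connEvent ends a₁ v ∩ Ω ends a₁ a₂) -
      prob p (S ends a₁ a₂ v) *
        prob p (connEvent ends a₁ v ∩ connEvent ends a₂ y ∩ Ω ends a₁ a₂)) *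
      prob p (N ends a₁ a₂ v ∩ avoidAll ends a₂ {z})

/-- **The tilt inequality `(TILT)`** of `MINE-C.md` §47.8 (c) as a cleared form (`(TILT)` is
`0 ≤ tiltForm`): `Sm·(Bev_Z̄·D₀ − Bev·D₀_Z̄) − (Sm − YS)·(H_Z̄·D₀ − H·D₀_Z̄)`. -/
noncomputable def tiltForm : R :=
  prob p (S ends a₁ a₂ v) *
      (prob p (bev ends a₁ a₂ v y ∩ avoidAll ends a₂ {z}) * prob p (N ends a₁ a₂ v) -
        prob p (bev ends a₁ a₂ v y) * prob p (N ends a₁ a₂ v ∩ avoidAll ends a₂ {z})) -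
    (prob p (S ends a₁ a₂ v) - prob p (connEvent ends a₂ y ∩ S ends a₁ a₂ v)) *
      (prob p (connEvent ends a₁ v ∩ Ω ends a₁ a₂ ∩ avoidAll ends a₂ {z}) * prob p (N ends a₁ a₂ v) -
        prob p (connEvent ends a₁ v ∩ Ω ends a₁ a₂) * prob p (N ends a₁ a₂ v ∩ avoidAll ends a₂ {z}))

end Statements

section Decomposition

variable {ends : E → Sym2 V} {a₁ a₂ v y z : V} {p : E → R}

omit [Fintype E] [DecidableEq E] [Fintype V] in
/-- `(0,1)` lives on `{v ∉ C₁}`, the other half of `Bev` on `{v ∈ C₁}`. -/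
lemma disjoint_uy_cls01 :
    Disjoint (connEvent ends a₁ v ∩ Ω ends a₁ a₂ ∩ (connEvent ends a₂ y)ᶜ) (cls01 ends a₁ a₂ v y) :=
  Set.disjoint_left.2 fun _ h1 h2 => h2.1.1 h1.1.1

omit [Fintype V] [LinearOrder R] [IsStrictOrderedRing R] in
/-- `P(Bev) = P(U ∩ Ω ∩ Yᶜ) + P((0,1))`. -/
lemma prob_bev :
    prob p (bev ends a₁ a₂ v y) =
      prob p (connEvent ends a₁ v ∩ Ω ends a₁ a₂ ∩ (connEvent ends a₂ y)ᶜ) +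
        prob p (cls01 ends a₁ a₂ v y) :=
  prob_union_of_disjoint p disjoint_uy_cls01

omit [Fintype V] [LinearOrder R] [IsStrictOrderedRing R] in
/-- `P(Bev ∩ Z̄) = P(U ∩ Ω ∩ Yᶜ ∩ Z̄) + P((0,1) ∩ Z̄)`. -/
lemma prob_bev_inter :
    prob p (bev ends a₁ a₂ v y ∩ avoidAll ends a₂ {z}) =
      prob p (connEvent ends a₁ v ∩ Ω ends a₁ a₂ ∩ (connEvent ends a₂ y)ᶜ ∩ avoidAll ends a₂ {z}) +
        prob p (cls01 ends a₁ a₂ v y ∩ avoidAll ends a₂ {z}) := by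
  rw [bev, Set.union_inter_distrib_right]
  exact prob_union_of_disjoint p
    (Set.disjoint_of_subset Set.inter_subset_left Set.inter_subset_left disjoint_uy_cls01)

omit [Fintype V] [DecidableEq V] in
/-- `P(U ∩ Ω ∩ Yᶜ) = P(U ∩ Ω) − P(U ∩ Y ∩ Ω)`. -/
lemma prob_uy_compl :
    prob p (connEvent ends a₁ v ∩ Ω ends a₁ a₂ ∩ (connEvent ends a₂ y)ᶜ) =
      prob p (connEvent ends a₁ v ∩ Ω ends a₁ a₂) -
        prob p (connEvent ends a₁ v ∩ connEvent ends a₂ y ∩ Ω ends a₁ a₂) := by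
  have h := prob_inter_add_prob_inter_compl p (connEvent ends a₁ v ∩ Ω ends a₁ a₂)
    (connEvent ends a₂ y)
  rw [Set.inter_right_comm] at h
  linarith

omit [Fintype V] [DecidableEq V] in
/-- `P(U ∩ Ω ∩ Yᶜ ∩ Z̄) = P(U ∩ Ω ∩ Z̄) − P(U ∩ Y ∩ Ω ∩ Z̄)`. -/
lemma prob_uy_compl_inter :
    prob p (connEvent ends a₁ v ∩ Ω ends a₁ a₂ ∩ (connEvent ends a₂ y)ᶜ ∩ avoidAll ends a₂ {z}) =
      prob p (connEvent ends a₁ v ∩ Ω ends a₁ a₂ ∩ avoidAll ends a₂ {z}) -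
        prob p (connEvent ends a₁ v ∩ connEvent ends a₂ y ∩ Ω ends a₁ a₂ ∩ avoidAll ends a₂ {z}) := by
  have h := prob_inter_add_prob_inter_compl p
    (connEvent ends a₁ v ∩ Ω ends a₁ a₂ ∩ avoidAll ends a₂ {z}) (connEvent ends a₂ y)
  have e1 : connEvent ends a₁ v ∩ Ω ends a₁ a₂ ∩ avoidAll ends a₂ {z} ∩ connEvent ends a₂ y =
      connEvent ends a₁ v ∩ connEvent ends a₂ y ∩ Ω ends a₁ a₂ ∩ avoidAll ends a₂ {z} := by
    ext ω; simp only [Set.mem_inter_iff]; tauto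
  have e2 : connEvent ends a₁ v ∩ Ω ends a₁ a₂ ∩ avoidAll ends a₂ {z} ∩ (connEvent ends a₂ y)ᶜ =
      connEvent ends a₁ v ∩ Ω ends a₁ a₂ ∩ (connEvent ends a₂ y)ᶜ ∩ avoidAll ends a₂ {z} := by
    ext ω; simp only [Set.mem_inter_iff, Set.mem_compl_iff]; tauto
  rw [e1, e2] at h
  linarith

omit [Fintype V] in
/-- **`(TILT)` is exactly `Sm · (a) + (e)`**: `tiltForm = Sm · (P((0,1) ∩ Z̄)·P(N) − P((0,1))·P(N ∩ Z̄)) + factEForm`. -/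
theorem tiltForm_eq :
    tiltForm ends a₁ a₂ v y z p =
      prob p (S ends a₁ a₂ v) *
          (prob p (cls01 ends a₁ a₂ v y ∩ avoidAll ends a₂ {z}) * prob p (N ends a₁ a₂ v) -
            prob p (cls01 ends a₁ a₂ v y) * prob p (N ends a₁ a₂ v ∩ avoidAll ends a₂ {z})) +
        factEForm ends a₁ a₂ v y z p := by
  unfold tiltForm factEForm
  rw [prob_bev, prob_bev_inter, prob_uy_compl, prob_uy_compl_inter]
  ring

/-- **`(TILT)` follows from fact `(e)`**: the tilt inequality of the frozen glue holds whenever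
`0 ≤ factEForm`, fact `(a)` being the theorem `cls01_avoid_a2_pa_harris'`. -/
theorem tiltForm_nonneg_of_factEForm_nonneg (hp : IsProbVec p) (hza₂ : z ≠ a₂)
    (he : 0 ≤ factEForm ends a₁ a₂ v y z p) : 0 ≤ tiltForm ends a₁ a₂ v y z p := by
  rw [tiltForm_eq]
  have ha := cls01_avoid_a2_pa_harris' (ends := ends) (a₁ := a₁) (v := v) (y := y) hp hza₂
  have hS : 0 ≤ prob p (S ends a₁ a₂ v) := prob_nonneg hp _
  exact add_nonneg (mul_nonneg hS (sub_nonneg.2 ha)) he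

end Decomposition

section Degenerate

variable {ends : E → Sym2 V} {a₁ a₂ v y : V} {p : E → R}

omit [Fintype E] [DecidableEq E] [Fintype V] in
/-- On `U ∩ Ω` the vertex `a₂` avoids `v`. -/
lemma uΩ_subset_avoid_v :
    connEvent ends a₁ v ∩ Ω ends a₁ a₂ ⊆ avoidAll ends a₂ {v} := by
  intro ω hω
  rw [U_inter_Ω_eq] at hω
  intro x hx hc
  exact hω.2 x (Finset.mem_insert_of_mem hx) hc

/-- `(e)` for `z = v`: `Z̄ ⊇ U ∩ Ω`, so the left-hand side is the BHK 1.4 slack times `D₀` and the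
right-hand side the same slack times `P(N ∩ Z̄) ≤ D₀`. -/
theorem factEForm_nonneg_of_z_eq_v (hp : IsProbVec p) : 0 ≤ factEForm ends a₁ a₂ v y v p := by
  unfold factEForm
  have e1 : connEvent ends a₁ v ∩ Ω ends a₁ a₂ ∩ avoidAll ends a₂ {v} =
      connEvent ends a₁ v ∩ Ω ends a₁ a₂ :=
    Set.inter_eq_left.2 uΩ_subset_avoid_v
  have e2 : connEvent ends a₁ v ∩ connEvent ends a₂ y ∩ Ω ends a₁ a₂ ∩ avoidAll ends a₂ {v} =
      connEvent ends a₁ v ∩ connEvent ends a₂ y ∩ Ω ends a₁ a₂ := by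
    refine Set.inter_eq_left.2 fun ω hω => uΩ_subset_avoid_v ⟨hω.1.1, hω.2⟩
  rw [e1, e2]
  have hslope := slope_ineq p ends a₁ a₂ v y hp
  have hN : prob p (N ends a₁ a₂ v ∩ avoidAll ends a₂ {v}) ≤ prob p (N ends a₁ a₂ v) :=
    prob_mono hp Set.inter_subset_left
  have hNZ : 0 ≤ prob p (N ends a₁ a₂ v ∩ avoidAll ends a₂ {v}) := prob_nonneg hp _
  nlinarith [hslope, hN, hNZ]

/-- `(e)` for `z = y`: `Y ∩ Z̄ = ∅`, and the difference of the two sides is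
`P(N ∩ Y)·(YS·H − Sm·D) + D·D₀·(Sm − YS) ≥ 0`. -/
theorem factEForm_nonneg_of_z_eq_y (hp : IsProbVec p) : 0 ≤ factEForm ends a₁ a₂ v y y p := by
  unfold factEForm
  have e0 : connEvent ends a₁ v ∩ connEvent ends a₂ y ∩ Ω ends a₁ a₂ ∩ avoidAll ends a₂ {y} = ∅ := by
    ext ω
    simp only [Set.mem_inter_iff, mem_connEvent, avoidAll, Set.mem_setOf_eq, Finset.mem_singleton,
      forall_eq, Set.mem_empty_iff_false, iff_false]
    rintro ⟨⟨⟨-, hy⟩, -⟩, hav⟩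
    exact hav hy
  have eUZ : prob p (connEvent ends a₁ v ∩ Ω ends a₁ a₂ ∩ avoidAll ends a₂ {y}) =
      prob p (connEvent ends a₁ v ∩ Ω ends a₁ a₂) -
        prob p (connEvent ends a₁ v ∩ connEvent ends a₂ y ∩ Ω ends a₁ a₂) := by
    have h := prob_inter_add_prob_inter_compl p (connEvent ends a₁ v ∩ Ω ends a₁ a₂)
      (connEvent ends a₂ y)
    have ec : (connEvent ends a₂ y)ᶜ = avoidAll ends a₂ {y} := by
      ext ω; simp [avoidAll, mem_connEvent]
    rw [Set.inter_right_comm, ec] at h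
    linarith
  have eNZ : prob p (N ends a₁ a₂ v ∩ avoidAll ends a₂ {y}) =
      prob p (N ends a₁ a₂ v) - prob p (N ends a₁ a₂ v ∩ connEvent ends a₂ y) := by
    have h := prob_inter_add_prob_inter_compl p (N ends a₁ a₂ v) (connEvent ends a₂ y)
    have ec : (connEvent ends a₂ y)ᶜ = avoidAll ends a₂ {y} := by
      ext ω; simp [avoidAll, mem_connEvent]
    rw [ec] at h
    linarith
  rw [e0, prob_empty, eUZ, eNZ]
  have hslope := slope_ineq p ends a₁ a₂ v y hp
  have hYS : prob p (connEvent ends a₂ y ∩ S ends a₁ a₂ v) ≤ prob p (S ends a₁ a₂ v) :=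
    prob_mono hp Set.inter_subset_right
  have hD : 0 ≤ prob p (connEvent ends a₁ v ∩ connEvent ends a₂ y ∩ Ω ends a₁ a₂) := prob_nonneg hp _
  have hD0 : 0 ≤ prob p (N ends a₁ a₂ v) := prob_nonneg hp _
  have hNY : 0 ≤ prob p (N ends a₁ a₂ v ∩ connEvent ends a₂ y) := prob_nonneg hp _
  nlinarith [hslope, hYS, hD, hD0, hNY, mul_nonneg hD hD0, mul_nonneg hNY (sub_nonneg.2 hslope)]

end Degenerate

end KPrime

end Summit.Ventures.PercRepro2
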